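import Summits.QuantumFields.YangMills.Theorems.UnitScaleTiltProp7JointRowOfLevelMasses
import HarnessLib

/-!
# Route `UnitScaleTilt`, crux K1 «MinimiserStabilityRegPr» (stmt-QuantumFields-19200), route-R E′ (A′) «HCOW-VIA-Σ», row P-A2 «JOINT-Σ», file F3″-A —
# THE TWISTED LEVEL-MASS INDUCTION (pure real bookkeeping): ACCUMULATED-FRAME MASSES DECAY LIKE THE SINGLE-BAR MASSES
# `Φ₀ = 0`, `Φ_{l+1} ≤ q·Φ_l + C·M_l`, `q·L ≤ ½`, `M_l ≤ A·M₀·L^{−l} + B·Lˡ` ⟹ `Φ_l ≤ 2LC·A·M₀·L^{−l} + C·B·Lˡ`, AND THEN `M^{tw}_l ≤ 3(M_l + 2d·Φ_l) ≤ (3 + 12dLC)·A·M₀·L^{−l} + (3 + 6dC)·B·Lˡ`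

Cell `ym3-torus`, width seat `ym3-torus-px22` (gen 3); ★p1 g17 WORD 10 (4) «F3″ → px22».  THE POINT (LOCATE `LOCATE-PA2-F3-LEVELMASSES-px22g3.md` (V3)): the covariant
double-bar tower `V^{(l)} = dbarCovIterU l` is the PLAIN tower in the ACCUMULATED frames `v_l = frameAccU l` ((97), ✓ `dbarCovIterU_eq_gaugeActT_frameAccU`), so its level masses are
`≤ 3·(single-bar mass + 2d·Σ_y‖v_l(y) − 1‖²)`; the accumulated-frame mass `Φ_l` obeys a one-step recursion whose self-coupling goes through block MEANS (`q ≍ L^{−d} + δ²`-junk, so `qL ≤ ½`)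
and whose source is the single-bar mass `M_l` of (n3) (✓ `Prop7FibreLevelMassPerLevelT3.sum_normSq_levelRatio_le_LOnly_T3`: `M_l ≤ 7M₀L^{−l} + B·Lˡ`).  This file is the induction that turns
the recursion into the `hM` shape of ✓ `Prop7JointRowOfLevelMasses.jointRow_of_levelMasses` with L-only constants; the one-step inequality itself (F3″-B) and the T³ knit (F3″-C) are separate files.
THEOREMS ONLY (0 `def`, 0 `sorry`), pure reals; `--supports stmt-QuantumFields-19200`, count-neutral.  YM₃ on T³ is a ladder rung (R3), not the Clay problem; nothing here claims the stub, the crux, d = 4 or the gap.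

References: T. Bałaban, CMP 98 (1985) 17–51 [Balaban1985Averaging] ((82) p.30, (89) p.31, (97) p.32, Prop. 3 (122)–(126) p.36); CMP 95 (1984) 17–40 [Balaban1984PropagatorsI] ((1.18)–(1.20) pp.19–20).
-/

set_option autoImplicit false

noncomputable section

namespace Summit.QuantumFields.YangMills.Theorems.Prop7TwistedLevelMassInduction

/-! ## §1 The accumulated-frame masses -/

/-- ★★ **THE ACCUMULATED-FRAME MASS INDUCTION**: if `Φ₀ = 0`, `Φ_{l+1} ≤ q·Φ_l + C·M_l` for `l < k` with `0 ≤ q`, `q·L ≤ ½`, and the single-bar masses obey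
`M_l ≤ A·M₀·(Lˡ)⁻¹ + B·Lˡ` (`l ≤ k`), then `Φ_l ≤ 2L·C·(A·M₀·(Lˡ)⁻¹) + C·(B·Lˡ)` for every `l ≤ k` — the invariant survives one step because `2Lq + 1 ≤ 2` and `q + 1 ≤ L`.
[cite: Balaban1985Averaging, (97) p.32, Prop. 3 (122)-(126) p.36] -/
theorem frameMass_induction {L q C A B M₀ : ℝ} (hL : 2 ≤ L) (hq : 0 ≤ q) (hqL : q * L ≤ 1 / 2) (hC : 0 ≤ C) (hA : 0 ≤ A) (hB : 0 ≤ B) (hM₀ : 0 ≤ M₀)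
    (k : ℕ) (Φ M : ℕ → ℝ) (hΦ0 : Φ 0 = 0) (hΦ : ∀ l < k, Φ (l + 1) ≤ q * Φ l + C * M l)
    (hM : ∀ l ≤ k, M l ≤ A * M₀ * (L ^ l)⁻¹ + B * L ^ l) :
    ∀ l ≤ k, Φ l ≤ 2 * L * C * (A * M₀ * (L ^ l)⁻¹) + C * (B * L ^ l) := by
  have hL0 : 0 < L := by linarith
  have hL1 : 1 ≤ L := by linarith
  intro l
  induction l with
  | zero =>
    intro _
    rw [hΦ0]
    positivity
  | succ l ih =>
    intro hl
    have hl' : l < k := Nat.lt_of_succ_le hl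
    have hΦl := ih hl'.le
    have hMl := hM l hl'.le
    have hstep := hΦ l hl'
    -- letters
    have hLl : 0 < L ^ l := pow_pos hL0 l
    have hx0 : 0 ≤ (L ^ l)⁻¹ := by positivity
    have epow : (L ^ (l + 1))⁻¹ = (L ^ l)⁻¹ * L⁻¹ := by rw [pow_succ, mul_inv]
    have epow' : L ^ (l + 1) = L ^ l * L := pow_succ L l
    -- the two comparisons of the step
    have h1 : q * (2 * L * C * (A * M₀ * (L ^ l)⁻¹)) + C * (A * M₀ * (L ^ l)⁻¹) ≤ 2 * L * C * (A * M₀ * (L ^ (l + 1))⁻¹) := by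
      rw [epow]
      have e : 2 * L * C * (A * M₀ * ((L ^ l)⁻¹ * L⁻¹)) = 2 * C * (A * M₀ * (L ^ l)⁻¹) * (L * L⁻¹) := by ring
      rw [e, mul_inv_cancel₀ hL0.ne', mul_one]
      have e2 : q * (2 * L * C * (A * M₀ * (L ^ l)⁻¹)) + C * (A * M₀ * (L ^ l)⁻¹) = (2 * (q * L) + 1) * (C * (A * M₀ * (L ^ l)⁻¹)) := by ring
      rw [e2]
      have hpos : 0 ≤ C * (A * M₀ * (L ^ l)⁻¹) := by positivity
      nlinarith
    have h2 : q * (C * (B * L ^ l)) + C * (B * L ^ l) ≤ C * (B * L ^ (l + 1)) := by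
      rw [epow']
      have e : q * (C * (B * L ^ l)) + C * (B * L ^ l) = (q + 1) * (C * (B * L ^ l)) := by ring
      have e2 : C * (B * (L ^ l * L)) = L * (C * (B * L ^ l)) := by ring
      rw [e, e2]
      have hpos : 0 ≤ C * (B * L ^ l) := by positivity
      have hqL' : q + 1 ≤ L := by nlinarith
      exact mul_le_mul_of_nonneg_right hqL' hpos
    calc Φ (l + 1) ≤ q * Φ l + C * M l := hstep
      _ ≤ q * (2 * L * C * (A * M₀ * (L ^ l)⁻¹) + C * (B * L ^ l)) + C * (A * M₀ * (L ^ l)⁻¹ + B * L ^ l) :=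
          add_le_add (mul_le_mul_of_nonneg_left hΦl hq) (mul_le_mul_of_nonneg_left hMl hC)
      _ = (q * (2 * L * C * (A * M₀ * (L ^ l)⁻¹)) + C * (A * M₀ * (L ^ l)⁻¹)) + (q * (C * (B * L ^ l)) + C * (B * L ^ l)) := by ring
      _ ≤ 2 * L * C * (A * M₀ * (L ^ (l + 1))⁻¹) + C * (B * L ^ (l + 1)) := add_le_add h1 h2

/-! ## §2 The twisted masses -/

/-- ★★ **THE TWISTED LEVEL MASSES**: with the frame masses of §1 and `M^{tw}_l ≤ 3·(M_l + 2d·Φ_l)` ((97): twisted link = `v(b₋)⁻¹·(single-bar link)·Ad(v(b₊))`),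
`M^{tw}_l ≤ (3 + 12·d·L·C)·(A·M₀·(Lˡ)⁻¹) + (3 + 6·d·C)·(B·Lˡ)` for every `l ≤ k` — the `hM` shape of ✓ `jointRow_of_levelMasses` with L-only constants.
[cite: Balaban1985Averaging, (89) p.31, (97) p.32, Prop. 3 (122)-(126) p.36] -/
theorem twistedMass_le {L q C A B M₀ d : ℝ} (hL : 2 ≤ L) (hq : 0 ≤ q) (hqL : q * L ≤ 1 / 2) (hC : 0 ≤ C) (hA : 0 ≤ A) (hB : 0 ≤ B) (hM₀ : 0 ≤ M₀) (hd : 0 ≤ d)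
    (k : ℕ) (Φ M Mtw : ℕ → ℝ) (hΦ0 : Φ 0 = 0) (hΦ : ∀ l < k, Φ (l + 1) ≤ q * Φ l + C * M l)
    (hM : ∀ l ≤ k, M l ≤ A * M₀ * (L ^ l)⁻¹ + B * L ^ l) (hMtw : ∀ l ≤ k, Mtw l ≤ 3 * (M l + 2 * d * Φ l)) :
    ∀ l ≤ k, Mtw l ≤ (3 + 12 * d * L * C) * (A * M₀ * (L ^ l)⁻¹) + (3 + 6 * d * C) * (B * L ^ l) := by
  intro l hl
  have hΦl := frameMass_induction hL hq hqL hC hA hB hM₀ k Φ M hΦ0 hΦ hM l hl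
  have hMl := hM l hl
  have h6 : 2 * d * Φ l ≤ 2 * d * (2 * L * C * (A * M₀ * (L ^ l)⁻¹) + C * (B * L ^ l)) := mul_le_mul_of_nonneg_left hΦl (by positivity)
  calc Mtw l ≤ 3 * (M l + 2 * d * Φ l) := hMtw l hl
    _ ≤ 3 * ((A * M₀ * (L ^ l)⁻¹ + B * L ^ l) + 2 * d * (2 * L * C * (A * M₀ * (L ^ l)⁻¹) + C * (B * L ^ l))) := by
        have := add_le_add hMl h6
        linarith
    _ = (3 + 12 * d * L * C) * (A * M₀ * (L ^ l)⁻¹) + (3 + 6 * d * C) * (B * L ^ l) := by ring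

/-- ★ **THE TWISTED LEVEL MASSES IN (n3)'s LETTERS** (`d = 3`, ✓ `sum_normSq_levelRatio_le_LOnly_T3`: `A = 7`, `B = c_B·KD + c_B′·ℓ⁻²·M₀` with `c_B = 28800L⁴`, `c_B′ = 600000L⁴`):
`M^{tw}_l ≤ (21 + 252·L·C)·M₀·(Lˡ)⁻¹ + (3 + 18·C)·(c_B·KD + c_B′·(L^k)⁻²·M₀)·Lˡ` — ready for ✓ `jointRow_currency` (`cA := 21 + 252LC`, `cB := (3+18C)c_B`, `cB′·ε := (3+18C)c_B′`).
[cite: Balaban1985Averaging, Prop. 3 (122)-(126) p.36; Balaban1984PropagatorsI, (1.18)-(1.20) pp.19-20] -/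
theorem twistedMass_le_LOnly {L q C M₀ KD cB cB' : ℝ} (hL : 2 ≤ L) (hq : 0 ≤ q) (hqL : q * L ≤ 1 / 2) (hC : 0 ≤ C) (hM₀ : 0 ≤ M₀) (hKD : 0 ≤ KD) (hcB : 0 ≤ cB) (hcB' : 0 ≤ cB')
    (k : ℕ) (Φ M Mtw : ℕ → ℝ) (hΦ0 : Φ 0 = 0) (hΦ : ∀ l < k, Φ (l + 1) ≤ q * Φ l + C * M l)
    (hM : ∀ l ≤ k, M l ≤ 7 * M₀ * (L ^ l)⁻¹ + (cB * KD + cB' * ((L ^ k) ^ 2)⁻¹ * M₀) * L ^ l) (hMtw : ∀ l ≤ k, Mtw l ≤ 3 * (M l + 2 * 3 * Φ l)) :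
    ∀ l ≤ k, Mtw l ≤ (21 + 252 * L * C) * (M₀ * (L ^ l)⁻¹) + (3 + 18 * C) * ((cB * KD + cB' * ((L ^ k) ^ 2)⁻¹ * M₀) * L ^ l) := by
  intro l hl
  have hB : 0 ≤ cB * KD + cB' * ((L ^ k) ^ 2)⁻¹ * M₀ := by positivity
  have h := twistedMass_le (d := 3) hL hq hqL hC (by norm_num : (0 : ℝ) ≤ 7) hB hM₀ (by norm_num) k Φ M Mtw hΦ0 hΦ hM hMtw l hl
  have e : (3 + 12 * 3 * L * C) * (7 * M₀ * (L ^ l)⁻¹) + (3 + 6 * 3 * C) * ((cB * KD + cB' * ((L ^ k) ^ 2)⁻¹ * M₀) * L ^ l)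
      = (21 + 252 * L * C) * (M₀ * (L ^ l)⁻¹) + (3 + 18 * C) * ((cB * KD + cB' * ((L ^ k) ^ 2)⁻¹ * M₀) * L ^ l) := by ring
  rw [← e]
  exact h

end Summit.QuantumFields.YangMills.Theorems.Prop7TwistedLevelMassInduction

end
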